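import Literature.Geometry.ComplexHyperbolic.UnitBallTransversalDatumFormInvariance   -- ★ (β1 abstract) A-p18: `datumForm_conj_eq`
import Literature.Geometry.ComplexHyperbolic.UnitBallTransversalRepresentativeSlots     -- ★ A-p18 p844677: `nsq_rep`
import Literature.Geometry.ComplexHyperbolic.UnitBallFrameTransport                    -- ★ F0P3a-p06 p844006 (W3): the frame `rotMat W r`, pencil transport
import Literature.Analysis.Calculus.NestedFDerivCompContinuousLinear                   -- ★ F0P3a-p06: `nestedFDeriv_two_comp_clm`, `fderiv_comp_clm_apply`
import HarnessLib

/-!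
# (β1, concrete) `K`-TRANSPORT OF THE χ-DATUM: for a `K = U(2)×U(1)`-conjugation-invariant `Θ`, A-p14's transversal datum `Λ_χ^Θ(t, W, ρ)` depends on `W` only through `|W|` —
# `Λ_χ^Θ(t, W, ρ) = Λ_χ^Θ(t, (s, 0), ρ)` whenever `nsq W = s²`, `s ≠ 0` (Rogawski 1990 §8.4; Goldman 1999 §3.1; the representative-ray device of p06's DESIGN-W6 §1)

Topic `Geometry/ComplexHyperbolic`; namespace `Literature.Geometry.ComplexHyperbolic.BallModel`.  THEOREMS ONLY (no `def`, no instance, no notation, no axiom, no named fact, no `sorry`).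
Cell `pub/hodgecm-mathlib`, ENGINE T1 (crux H413 = `stmt-HodgeConjecture-24833`); ROAD A, (A4-iii) «THE VALUE», brick (β) «POINTWISE χ-JET IDENTITY at `W = s•ω`» (WORD R-14.8∕R-14.9),
part (β1) concrete, over ★ (β1 abstract) `TransversalForm.datumForm_conj_eq`, ★ p06's frame `rotMat W s` (`UnitBallFrameTransport`), ★ p06's `NestedFDerivCompContinuousLinear`.
Author A-p18 (g26), 2026-09-01.

WHAT IS PROVED.
* §1 `iteratedFDeriv_two_conj_eq_of_kInvariant`, `fderiv_conj_eq_of_kInvariant`: if `Θ(κXκᴴ) = Θ X` for all `X` (`κκᴴ = 1`), then `D²Θ(κYκᴴ)[A, B] = D²Θ(Y)[κᴴAκ, κᴴBκ]` and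
  `DΘ(κYκᴴ)[A] = DΘ(Y)[κᴴAκ]` (`Θ = Θ ∘ Ad κ` + the chain rule through the real CLM `mulLeftRight κ κᴴ`).
* §2 **`transversalDatum_eq_rep_of_kInvariant`**: for `Θ ∈ C²` with `Θ(κXκᴴ) = Θ X` for every `κ` with `κκᴴ = 1`, `κJ = Jκ`, every `ζ`, `W` with `nsq W = s²` (`s ≠ 0`), `t, ρ`:
  `Λ_χ^Θ(t, W, ρ) = Λ_χ^Θ(t, (s,0), ρ)` — A-p14's datum λ VERBATIM on both sides.  PROOF: with `κ = rotMat W s` (★ unitary, commutes with `J`, `κ·(s,0,ρ) = (W₀,W₁,ρ)`):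
  `h_W = κ h_rep κᴴ`, `N_W = κ N_rep κᴴ` (★ `pencil_vecCons_eq_conj`, `vecMulVec_vecCons_mul_J_eq_conj`), §1 on every jet, then ★ `datumForm_conj_eq` with `M = κᴴ`, `M′ = κ` for
  `q₂ = D²Θ(h_rep)`, `q₁ = DΘ(h_rep)`.
CONSEQUENCE ((β) assembled, for (α)∕W6): the χ″(0⁺)-density `D²Λ_χ(0,W,|W|)[(1,0,b_W)]² + DΛ_χ[(0,0,σ_W)]` of a `K`-invariant `Θ` at `W = s•ω` equals ★ (β2)
`fderiv_fderiv_add_fderiv_transversalDatum_rep_eq` at `(s, 0)` — the `(t,ρ)`-jets of two functions that agree for all `(t,ρ)` agree (one-variable calculus along the line, ★ A-p14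
`iteratedDeriv_two_transversalDatum_line`; left to the assembler).
HONEST LABEL: transport bookkeeping; pays nothing by itself (HC_CM is proved only modulo the printed citations until rung 0 closes).

## References
* [Rogawski1990] J. D. Rogawski, *Automorphic Representations of Unitary Groups in Three Variables*, Ann. of Math. Stud. 123 (1990), §8.4 pp. 126–127.
* [Goldman1999] W. M. Goldman, *Complex Hyperbolic Geometry* (1999), §3.1.1–3.1.2.
* [Dieudonne1960] J. Dieudonné, *Foundations of Modern Analysis* (1960), Ch. VIII §12.
-/

set_option autoImplicit false

noncomputable section

open Matrix Complex
open Literature.Analysis.Calculus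
open scoped Matrix.Norms.Operator ComplexConjugate

namespace Literature.Geometry.ComplexHyperbolic.BallModel

open RepresentativeSlots

variable {G : Type*} [NormedAddCommGroup G] [NormedSpace ℝ G]

/-! ## §1 `K`-invariance of the first and second jets -/

/-- `κ(κᴴAκ)κᴴ = A` for `κκᴴ = 1`. [cite: Goldman1999, §3.1.1] -/
theorem conj_conjTranspose_conj {κ : Matrix (Fin 3) (Fin 3) ℂ} (hκ1 : κ * κᴴ = 1) (A : Matrix (Fin 3) (Fin 3) ℂ) : κ * (κᴴ * A * κ) * κᴴ = A := by
  rw [show κ * (κᴴ * A * κ) * κᴴ = (κ * κᴴ) * A * (κ * κᴴ) by simp only [Matrix.mul_assoc], hκ1, Matrix.one_mul, Matrix.mul_one]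

/-- **Second jets of a `K`-invariant function**: `D²Θ(κYκᴴ)[A, B] = D²Θ(Y)[κᴴAκ, κᴴBκ]` (`iteratedFDeriv` form) when `Θ(κXκᴴ) = Θ X` for all `X`, `κκᴴ = 1`.
[cite: Dieudonne1960, Ch. VIII §12] -/
theorem iteratedFDeriv_two_conj_eq_of_kInvariant (Θ : Matrix (Fin 3) (Fin 3) ℂ → G) (hΘ : ContDiff ℝ 2 Θ) {κ : Matrix (Fin 3) (Fin 3) ℂ} (hκ1 : κ * κᴴ = 1) (hK : ∀ X, Θ (κ * X * κᴴ) = Θ X) (Y A B : Matrix (Fin 3) (Fin 3) ℂ) :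
    iteratedFDeriv ℝ 2 Θ (κ * Y * κᴴ) ![A, B] = iteratedFDeriv ℝ 2 Θ Y ![κᴴ * A * κ, κᴴ * B * κ] := by
  have hcomp : Θ ∘ ⇑(ContinuousLinearMap.mulLeftRight ℝ (Matrix (Fin 3) (Fin 3) ℂ) κ κᴴ) = Θ :=
    funext fun X => by rw [Function.comp_apply, mulLeftRight_conjTranspose_apply]; exact hK X
  have h := iteratedFDeriv_comp_clm_apply (ContinuousLinearMap.mulLeftRight ℝ (Matrix (Fin 3) (Fin 3) ℂ) κ κᴴ) hΘ Y (j := 2) le_rfl ![κᴴ * A * κ, κᴴ * B * κ]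
  have hv : (fun i => ContinuousLinearMap.mulLeftRight ℝ (Matrix (Fin 3) (Fin 3) ℂ) κ κᴴ ((![κᴴ * A * κ, κᴴ * B * κ] : Fin 2 → Matrix (Fin 3) (Fin 3) ℂ) i)) = ![A, B] := by
    funext i
    fin_cases i <;> simp [conj_conjTranspose_conj hκ1]
  rw [hcomp, mulLeftRight_conjTranspose_apply, hv] at h
  exact h.symm

/-- **First jets of a `K`-invariant function**: `DΘ(κYκᴴ)[A] = DΘ(Y)[κᴴAκ]`. [cite: Dieudonne1960, Ch. VIII §12] -/
theorem fderiv_conj_eq_of_kInvariant (Θ : Matrix (Fin 3) (Fin 3) ℂ → G) (hΘ : ContDiff ℝ 2 Θ) {κ : Matrix (Fin 3) (Fin 3) ℂ} (hκ1 : κ * κᴴ = 1) (hK : ∀ X, Θ (κ * X * κᴴ) = Θ X) (Y A : Matrix (Fin 3) (Fin 3) ℂ) :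
    fderiv ℝ Θ (κ * Y * κᴴ) A = fderiv ℝ Θ Y (κᴴ * A * κ) := by
  have hcomp : Θ ∘ ⇑(ContinuousLinearMap.mulLeftRight ℝ (Matrix (Fin 3) (Fin 3) ℂ) κ κᴴ) = Θ :=
    funext fun X => by rw [Function.comp_apply, mulLeftRight_conjTranspose_apply]; exact hK X
  have hd : DifferentiableAt ℝ Θ (ContinuousLinearMap.mulLeftRight ℝ (Matrix (Fin 3) (Fin 3) ℂ) κ κᴴ Y) := (hΘ.differentiable (by norm_num)) _
  have h := fderiv_comp_clm_apply (ContinuousLinearMap.mulLeftRight ℝ (Matrix (Fin 3) (Fin 3) ℂ) κ κᴴ) hd (κᴴ * A * κ)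
  rw [hcomp, mulLeftRight_conjTranspose_apply, mulLeftRight_conjTranspose_apply, conj_conjTranspose_conj hκ1] at h
  exact h.symm

/-! ## §2 The χ-datum of a `K`-invariant `Θ` depends on `W` only through `|W|` -/

/-- **(β1) `K`-TRANSPORT OF THE χ-DATUM TO THE REPRESENTATIVE POINT** — see the module docstring. [cite: Rogawski1990, §8.4 pp. 126–127] [cite: Goldman1999, §3.1.1–3.1.2] -/
theorem transversalDatum_eq_rep_of_kInvariant (Θ : Matrix (Fin 3) (Fin 3) ℂ → G) (hΘ : ContDiff ℝ 2 Θ)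
    (hK : ∀ κ : Matrix (Fin 3) (Fin 3) ℂ, κ * κᴴ = 1 → κ * J = J * κ → ∀ X, Θ (κ * X * κᴴ) = Θ X) (ζ : Circle) (W : Fin 2 → ℂ) {s : ℝ} (hs : s ≠ 0) (hW : nsq W = s ^ 2)
    (t ρ : ℝ) :
    (fun p : ℝ × (Fin 2 → ℂ) × ℝ =>
          ((1 / 3 : ℝ) • ((∑ k, ∑ l, ((J k k * J l l).re • (iteratedFDeriv ℝ 2 Θ (((ζ * Circle.exp p.1 : Circle) : ℂ) • (1 : Matrix (Fin 3) (Fin 3) ℂ) + (I * (ζ : ℂ) * Complex.exp (-(p.1 / 2 : ℝ) * I)) • (vecMulVec ![p.2.1 0, p.2.1 1, (p.2.2 : ℂ)] (star ![p.2.1 0, p.2.1 1, (p.2.2 : ℂ)]) * J)) ![((ζ * Circle.exp p.1 : Circle) : ℂ) • (Matrix.single k l (1 : ℂ) * (((p.2.2 ^ 2 - nsq p.2.1 : ℝ) : ℂ) • (1 : Matrix (Fin 3) (Fin 3) ℂ) + (vecMulVec ![p.2.1 0, p.2.1 1, (p.2.2 : ℂ)] (star ![p.2.1 0, p.2.1 1,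 (p.2.2 : ℂ)]) * J))), ((ζ * Circle.exp p.1 : Circle) : ℂ) • ((((p.2.2 ^ 2 - nsq p.2.1 : ℝ) : ℂ) • (1 : Matrix (Fin 3) (Fin 3) ℂ) + (vecMulVec ![p.2.1 0, p.2.1 1, (p.2.2 : ℂ)] (star ![p.2.1 0, p.2.1 1, (p.2.2 : ℂ)]) * J)) * Matrix.single k l (1 : ℂ))] +
                  iteratedFDeriv ℝ 2 Θ (((ζ * Circle.exp p.1 : Circle) : ℂ) • (1 : Matrix (Fin 3) (Fin 3) ℂ) + (I * (ζ : ℂ) * Complex.exp (-(p.1 / 2 : ℝ) * I)) • (vecMulVec ![p.2.1 0, p.2.1 1, (p.2.2 : ℂ)] (star ![p.2.1 0, p.2.1 1, (p.2.2 : ℂ)]) * J)) ![((ζ * Circle.exp p.1 : Circle) : ℂ) • (I • (Matrix.single k l (1 : ℂ) * (((p.2.2 ^ 2 - nsq p.2.1 : ℝ) : ℂ) • (1 : Matrix (Fin 3) (Fin 3) ℂ) + (vecMulVec ![p.2.1 0, p.2.1 1, (p.2.2 : ℂ)] (star ![p.2.1 0, p.2.1 1, (p.2.2 : ℂ)]) *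 J)))), ((ζ * Circle.exp p.1 : Circle) : ℂ) • (I • ((((p.2.2 ^ 2 - nsq p.2.1 : ℝ) : ℂ) • (1 : Matrix (Fin 3) (Fin 3) ℂ) + (vecMulVec ![p.2.1 0, p.2.1 1, (p.2.2 : ℂ)] (star ![p.2.1 0, p.2.1 1, (p.2.2 : ℂ)]) * J)) * Matrix.single k l (1 : ℂ)))]) -
                iteratedFDeriv ℝ 2 Θ (((ζ * Circle.exp p.1 : Circle) : ℂ) • (1 : Matrix (Fin 3) (Fin 3) ℂ) + (I * (ζ : ℂ) * Complex.exp (-(p.1 / 2 : ℝ) * I)) • (vecMulVec ![p.2.1 0, p.2.1 1, (p.2.2 : ℂ)] (star ![p.2.1 0, p.2.1 1, (p.2.2 : ℂ)]) * J)) ![((ζ * Circle.exp p.1 : Circle) : ℂ) • (Matrix.single k l (1 : ℂ) * (((p.2.2 ^ 2 - nsq p.2.1 : ℝ) : ℂ) • (1 : Matrix (Fin 3) (Fin 3) ℂ) + (vecMulVec ![p.2.1 0, p.2.1 1, (p.2.2 : ℂ)] (star ![p.2.1 0, p.2.1 1, (p.2.2 : ℂ)]) * J))), ((ζ * Circle.exp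 p.1 : Circle) : ℂ) • (Matrix.single l k (1 : ℂ) * (((p.2.2 ^ 2 - nsq p.2.1 : ℝ) : ℂ) • (1 : Matrix (Fin 3) (Fin 3) ℂ) + (vecMulVec ![p.2.1 0, p.2.1 1, (p.2.2 : ℂ)] (star ![p.2.1 0, p.2.1 1, (p.2.2 : ℂ)]) * J)))] +
                iteratedFDeriv ℝ 2 Θ (((ζ * Circle.exp p.1 : Circle) : ℂ) • (1 : Matrix (Fin 3) (Fin 3) ℂ) + (I * (ζ : ℂ) * Complex.exp (-(p.1 / 2 : ℝ) * I)) • (vecMulVec ![p.2.1 0, p.2.1 1, (p.2.2 : ℂ)] (star ![p.2.1 0, p.2.1 1, (p.2.2 : ℂ)]) * J)) ![((ζ * Circle.exp p.1 : Circle) : ℂ) • (I • (Matrix.single k l (1 : ℂ) * (((p.2.2 ^ 2 - nsq p.2.1 : ℝ) : ℂ) • (1 : Matrix (Fin 3) (Fin 3) ℂ) + (vecMulVec ![p.2.1 0, p.2.1 1, (p.2.2 : ℂ)] (star ![p.2.1 0, p.2.1 1, (p.2.2 : ℂ)]) * J)))), ((ζ * Circle.exp p.1 : Circle) : ℂ)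 • (I • (Matrix.single l k (1 : ℂ) * (((p.2.2 ^ 2 - nsq p.2.1 : ℝ) : ℂ) • (1 : Matrix (Fin 3) (Fin 3) ℂ) + (vecMulVec ![p.2.1 0, p.2.1 1, (p.2.2 : ℂ)] (star ![p.2.1 0, p.2.1 1, (p.2.2 : ℂ)]) * J))))])) -
              iteratedFDeriv ℝ 2 Θ (((ζ * Circle.exp p.1 : Circle) : ℂ) • (1 : Matrix (Fin 3) (Fin 3) ℂ) + (I * (ζ : ℂ) * Complex.exp (-(p.1 / 2 : ℝ) * I)) • (vecMulVec ![p.2.1 0, p.2.1 1, (p.2.2 : ℂ)] (star ![p.2.1 0, p.2.1 1, (p.2.2 : ℂ)]) * J)) ![((ζ * Circle.exp p.1 : Circle) : ℂ) • (I • (((p.2.2 ^ 2 - nsq p.2.1 : ℝ) : ℂ) • (1 : Matrix (Fin 3) (Fin 3) ℂ) + (vecMulVec ![p.2.1 0, p.2.1 1, (p.2.2 : ℂ)] (star ![p.2.1 0, p.2.1 1, (p.2.2 : ℂ)]) * J))), ((ζ * Circle.exp p.1 : Circle) : ℂ) • (I • (((p.2.2 ^ 2 - nsq p.2.1 : ℝ)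 : ℂ) • (1 : Matrix (Fin 3) (Fin 3) ℂ) + (vecMulVec ![p.2.1 0, p.2.1 1, (p.2.2 : ℂ)] (star ![p.2.1 0, p.2.1 1, (p.2.2 : ℂ)]) * J)))]) -
            (p.2.2 ^ 2 - nsq p.2.1) • fderiv ℝ Θ (((ζ * Circle.exp p.1 : Circle) : ℂ) • (1 : Matrix (Fin 3) (Fin 3) ℂ) + (I * (ζ : ℂ) * Complex.exp (-(p.1 / 2 : ℝ) * I)) • (vecMulVec ![p.2.1 0, p.2.1 1, (p.2.2 : ℂ)] (star ![p.2.1 0, p.2.1 1, (p.2.2 : ℂ)]) * J)) (((ζ * Circle.exp p.1 : Circle) : ℂ) • (((p.2.2 ^ 2 - nsq p.2.1 : ℝ) : ℂ) • (1 : Matrix (Fin 3) (Fin 3) ℂ) + (vecMulVec ![p.2.1 0, p.2.1 1, (p.2.2 : ℂ)] (star ![p.2.1 0, p.2.1 1, (p.2.2 : ℂ)]) * J))))) (t, W, ρ) =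
    (fun p : ℝ × (Fin 2 → ℂ) × ℝ =>
          ((1 / 3 : ℝ) • ((∑ k, ∑ l, ((J k k * J l l).re • (iteratedFDeriv ℝ 2 Θ (((ζ * Circle.exp p.1 : Circle) : ℂ) • (1 : Matrix (Fin 3) (Fin 3) ℂ) + (I * (ζ : ℂ) * Complex.exp (-(p.1 / 2 : ℝ) * I)) • (vecMulVec ![p.2.1 0, p.2.1 1, (p.2.2 : ℂ)] (star ![p.2.1 0, p.2.1 1, (p.2.2 : ℂ)]) * J)) ![((ζ * Circle.exp p.1 : Circle) : ℂ) • (Matrix.single k l (1 : ℂ) * (((p.2.2 ^ 2 - nsq p.2.1 : ℝ) : ℂ) • (1 : Matrix (Fin 3) (Fin 3) ℂ) + (vecMulVec ![p.2.1 0, p.2.1 1, (p.2.2 : ℂ)] (star ![p.2.1 0, p.2.1 1, (p.2.2 : ℂ)]) * J))), ((ζ * Circle.exp p.1 : Circle) : ℂ) • ((((p.2.2 ^ 2 - nsq p.2.1 : ℝ) : ℂ) • (1 : Matrix (Fin 3) (Fin 3) ℂ) + (vecMulVec ![p.2.1 0, p.2.1 1, (p.2.2 : ℂ)] (star ![p.2.1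 0, p.2.1 1, (p.2.2 : ℂ)]) * J)) * Matrix.single k l (1 : ℂ))] +
                  iteratedFDeriv ℝ 2 Θ (((ζ * Circle.exp p.1 : Circle) : ℂ) • (1 : Matrix (Fin 3) (Fin 3) ℂ) + (I * (ζ : ℂ) * Complex.exp (-(p.1 / 2 : ℝ) * I)) • (vecMulVec ![p.2.1 0, p.2.1 1, (p.2.2 : ℂ)] (star ![p.2.1 0, p.2.1 1, (p.2.2 : ℂ)]) * J)) ![((ζ * Circle.exp p.1 : Circle) : ℂ) • (I • (Matrix.single k l (1 : ℂ) * (((p.2.2 ^ 2 - nsq p.2.1 : ℝ) : ℂ) • (1 : Matrix (Fin 3) (Fin 3) ℂ) + (vecMulVec ![p.2.1 0, p.2.1 1, (p.2.2 : ℂ)] (star ![p.2.1 0, p.2.1 1, (p.2.2 : ℂ)]) * J)))), ((ζ * Circle.exp p.1 : Circle) : ℂ) • (I • ((((p.2.2 ^ 2 - nsq p.2.1 : ℝ) : ℂ) • (1 : Matrix (Fin 3) (Fin 3) ℂ) + (vecMulVec ![p.2.1 0, p.2.1 1, (p.2.2 : ℂ)] (star ![p.2.1 0, p.2.1 1, (p.2.2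 : ℂ)]) * J)) * Matrix.single k l (1 : ℂ)))]) -
                iteratedFDeriv ℝ 2 Θ (((ζ * Circle.exp p.1 : Circle) : ℂ) • (1 : Matrix (Fin 3) (Fin 3) ℂ) + (I * (ζ : ℂ) * Complex.exp (-(p.1 / 2 : ℝ) * I)) • (vecMulVec ![p.2.1 0, p.2.1 1, (p.2.2 : ℂ)] (star ![p.2.1 0, p.2.1 1, (p.2.2 : ℂ)]) * J)) ![((ζ * Circle.exp p.1 : Circle) : ℂ) • (Matrix.single k l (1 : ℂ) * (((p.2.2 ^ 2 - nsq p.2.1 : ℝ) : ℂ) • (1 : Matrix (Fin 3) (Fin 3) ℂ) + (vecMulVec ![p.2.1 0, p.2.1 1, (p.2.2 : ℂ)] (star ![p.2.1 0, p.2.1 1, (p.2.2 : ℂ)]) * J))), ((ζ * Circle.exp p.1 : Circle) : ℂ) • (Matrix.single l k (1 : ℂ) * (((p.2.2 ^ 2 - nsq p.2.1 : ℝ) : ℂ) • (1 : Matrix (Fin 3) (Fin 3) ℂ) + (vecMulVec ![p.2.1 0, p.2.1 1, (p.2.2 : ℂ)] (star ![p.2.1 0, p.2.1 1, (p.2.2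 : ℂ)]) * J)))] +
                iteratedFDeriv ℝ 2 Θ (((ζ * Circle.exp p.1 : Circle) : ℂ) • (1 : Matrix (Fin 3) (Fin 3) ℂ) + (I * (ζ : ℂ) * Complex.exp (-(p.1 / 2 : ℝ) * I)) • (vecMulVec ![p.2.1 0, p.2.1 1, (p.2.2 : ℂ)] (star ![p.2.1 0, p.2.1 1, (p.2.2 : ℂ)]) * J)) ![((ζ * Circle.exp p.1 : Circle) : ℂ) • (I • (Matrix.single k l (1 : ℂ) * (((p.2.2 ^ 2 - nsq p.2.1 : ℝ) : ℂ) • (1 : Matrix (Fin 3) (Fin 3) ℂ) + (vecMulVec ![p.2.1 0, p.2.1 1, (p.2.2 : ℂ)] (star ![p.2.1 0, p.2.1 1, (p.2.2 : ℂ)]) * J)))), ((ζ * Circle.exp p.1 : Circle) : ℂ) • (I • (Matrix.single l k (1 : ℂ) * (((p.2.2 ^ 2 - nsq p.2.1 : ℝ) : ℂ) • (1 : Matrix (Fin 3) (Fin 3) ℂ) + (vecMulVec ![p.2.1 0, p.2.1 1, (p.2.2 : ℂ)] (star ![p.2.1 0, p.2.1 1, (p.2.2 : ℂ)]) * J))))]))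 -
              iteratedFDeriv ℝ 2 Θ (((ζ * Circle.exp p.1 : Circle) : ℂ) • (1 : Matrix (Fin 3) (Fin 3) ℂ) + (I * (ζ : ℂ) * Complex.exp (-(p.1 / 2 : ℝ) * I)) • (vecMulVec ![p.2.1 0, p.2.1 1, (p.2.2 : ℂ)] (star ![p.2.1 0, p.2.1 1, (p.2.2 : ℂ)]) * J)) ![((ζ * Circle.exp p.1 : Circle) : ℂ) • (I • (((p.2.2 ^ 2 - nsq p.2.1 : ℝ) : ℂ) • (1 : Matrix (Fin 3) (Fin 3) ℂ) + (vecMulVec ![p.2.1 0, p.2.1 1, (p.2.2 : ℂ)] (star ![p.2.1 0, p.2.1 1, (p.2.2 : ℂ)]) * J))), ((ζ * Circle.exp p.1 : Circle) : ℂ) • (I • (((p.2.2 ^ 2 - nsq p.2.1 : ℝ) : ℂ) • (1 : Matrix (Fin 3) (Fin 3) ℂ) + (vecMulVec ![p.2.1 0, p.2.1 1, (p.2.2 : ℂ)] (star ![p.2.1 0, p.2.1 1, (p.2.2 : ℂ)]) * J)))]) -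
            (p.2.2 ^ 2 - nsq p.2.1) • fderiv ℝ Θ (((ζ * Circle.exp p.1 : Circle) : ℂ) • (1 : Matrix (Fin 3) (Fin 3) ℂ) + (I * (ζ : ℂ) * Complex.exp (-(p.1 / 2 : ℝ) * I)) • (vecMulVec ![p.2.1 0, p.2.1 1, (p.2.2 : ℂ)] (star ![p.2.1 0, p.2.1 1, (p.2.2 : ℂ)]) * J)) (((ζ * Circle.exp p.1 : Circle) : ℂ) • (((p.2.2 ^ 2 - nsq p.2.1 : ℝ) : ℂ) • (1 : Matrix (Fin 3) (Fin 3) ℂ) + (vecMulVec ![p.2.1 0, p.2.1 1, (p.2.2 : ℂ)] (star ![p.2.1 0, p.2.1 1, (p.2.2 : ℂ)]) * J))))) (t, (![(s : ℂ), 0] : Fin 2 → ℂ), ρ) := by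
  -- the frame
  have hκ1 := rotMat_mul_conjTranspose_self W hs hW
  have hκ1' := conjTranspose_rotMat_mul_self W hs hW
  have hκJ := rotMat_mul_J W s
  have hKκ : ∀ X, Θ (rotMat W s * X * (rotMat W s)ᴴ) = Θ X := hK _ hκ1 hκJ
  have hMJ : ((rotMat W s)ᴴ)ᴴ * J * (rotMat W s)ᴴ = J := by
    rw [conjTranspose_conjTranspose, hκJ, Matrix.mul_assoc, hκ1, Matrix.mul_one]
  simp only [hW, nsq_rep, Matrix.cons_val_zero, Matrix.cons_val_one]
  -- transport the pencil and `N` on the left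
  rw [pencil_vecCons_eq_conj W hs hW, vecMulVec_vecCons_mul_J_eq_conj W hs]
  have hPfold : (((ρ ^ 2 - s ^ 2 : ℝ)) : ℂ) • (1 : Matrix (Fin 3) (Fin 3) ℂ) + rotMat W s * (vecMulVec ![(s : ℂ), 0, (ρ : ℂ)] (star ![(s : ℂ), 0, (ρ : ℂ)]) * J) * (rotMat W s)ᴴ =
      rotMat W s * ((((ρ ^ 2 - s ^ 2 : ℝ)) : ℂ) • (1 : Matrix (Fin 3) (Fin 3) ℂ) + vecMulVec ![(s : ℂ), 0, (ρ : ℂ)] (star ![(s : ℂ), 0, (ρ : ℂ)]) * J) * (rotMat W s)ᴴ := by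
    rw [conj_add_eq, conj_smul_eq, Matrix.mul_one, hκ1]
  rw [hPfold]
  simp only [iteratedFDeriv_two_conj_eq_of_kInvariant Θ hΘ hκ1 hKκ, fderiv_conj_eq_of_kInvariant Θ hΘ hκ1 hKκ]
  -- package the jets at the representative pencil as real-(bi)linear maps and apply the abstract transport
  obtain ⟨q₂, hq₂⟩ : ∃ q₂ : Matrix (Fin 3) (Fin 3) ℂ →ₗ[ℝ] Matrix (Fin 3) (Fin 3) ℂ →ₗ[ℝ] G, ∀ A B, q₂ A B = iteratedFDeriv ℝ 2 Θ (((ζ * Circle.exp t : Circle) : ℂ) • (1 : Matrix (Fin 3) (Fin 3) ℂ) + (I * (ζ : ℂ) * Complex.exp (-(t / 2 : ℝ) * I)) • (vecMulVec ![(s : ℂ), 0, (ρ : ℂ)] (star ![(s : ℂ), 0, (ρ : ℂ)]) * J)) ![A, B] :=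
    ⟨LinearMap.mk₂ ℝ (fun A B => iteratedFDeriv ℝ 2 Θ (((ζ * Circle.exp t : Circle) : ℂ) • (1 : Matrix (Fin 3) (Fin 3) ℂ) + (I * (ζ : ℂ) * Complex.exp (-(t / 2 : ℝ) * I)) • (vecMulVec ![(s : ℂ), 0, (ρ : ℂ)] (star ![(s : ℂ), 0, (ρ : ℂ)]) * J)) ![A, B])
      (fun A₁ A₂ B => by simp only [iteratedFDeriv_two_apply, Matrix.cons_val_zero, Matrix.cons_val_one, map_add, _root_.add_apply])
      (fun r A B => by simp only [iteratedFDeriv_two_apply, Matrix.cons_val_zero, Matrix.cons_val_one, map_smul, _root_.smul_apply])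
      (fun A B₁ B₂ => by simp only [iteratedFDeriv_two_apply, Matrix.cons_val_zero, Matrix.cons_val_one, map_add])
      (fun r A B => by simp only [iteratedFDeriv_two_apply, Matrix.cons_val_zero, Matrix.cons_val_one, map_smul]), fun A B => rfl⟩
  obtain ⟨q₁, hq₁⟩ : ∃ q₁ : Matrix (Fin 3) (Fin 3) ℂ →ₗ[ℝ] G, ∀ A, q₁ A = fderiv ℝ Θ (((ζ * Circle.exp t : Circle) : ℂ) • (1 : Matrix (Fin 3) (Fin 3) ℂ) + (I * (ζ : ℂ) * Complex.exp (-(t / 2 : ℝ) * I)) • (vecMulVec ![(s : ℂ), 0, (ρ : ℂ)] (star ![(s : ℂ), 0, (ρ : ℂ)]) * J)) A :=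
    ⟨(fderiv ℝ Θ (((ζ * Circle.exp t : Circle) : ℂ) • (1 : Matrix (Fin 3) (Fin 3) ℂ) + (I * (ζ : ℂ) * Complex.exp (-(t / 2 : ℝ) * I)) • (vecMulVec ![(s : ℂ), 0, (ρ : ℂ)] (star ![(s : ℂ), 0, (ρ : ℂ)]) * J))).toLinearMap, fun A => rfl⟩
  simp only [← hq₂, ← hq₁]
  have key := TransversalForm.datumForm_conj_eq q₂ q₁ ((ζ * Circle.exp t : Circle) : ℂ) (ρ ^ 2 - s ^ 2) ((((ρ ^ 2 - s ^ 2 : ℝ)) : ℂ) • (1 : Matrix (Fin 3) (Fin 3) ℂ) + vecMulVec ![(s : ℂ), 0, (ρ : ℂ)] (star ![(s : ℂ), 0, (ρ : ℂ)]) * J) (rotMat W s)ᴴ (rotMat W s) hκ1' hMJ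
  exact key

end Literature.Geometry.ComplexHyperbolic.BallModel

end
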